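import Literature.MathematicalPhysics.QuantumFieldTheory.Chatterjee2026YMHiggs.ProcaFieldMass
import Mathlib.Analysis.SpecialFunctions.Gaussian.GaussianIntegral
import Mathlib.MeasureTheory.Function.JacobianOneDim
import Mathlib.Analysis.SpecialFunctions.Trigonometric.DerivHyp
import HarnessLib

/-!
# Chatterjee's asymptotics of the Proca/free kernel `K_λ` (Lemma 4.7) — proved

S. Chatterjee, *A scaling limit of `SU(2)` lattice Yang–Mills–Higgs theory*, Probab. Math. Phys.
**7** (2026) 339–381, arXiv:2401.10507 [Chatterjee2026YMHiggs], §4.5 **Lemma 4.7**: as `‖x‖ → ∞`,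
`K_λ(x) ∼ λ^{(d−3)/4} e^{−√λ‖x‖} / (2 (2π)^{(d−1)/2} ‖x‖^{(d−1)/2})`, where
`K_λ(x) = ∫₀^∞ (4πt)^{−d/2} exp(−‖x‖²/(4t) − λt) dt` is the kernel of (2.1) (`λ = m²`; the free
covariance kernel `K_m(x) = ∫₀^∞ e^{−m²t} p_t(x) dt` of the tree, `heatKernel`). This file DISCHARGES
the named fact `Chatterjee2026YMHiggs.kernelK_asymptotics` of `ProcaFieldMass` (D-0014):
`kernelK_asymptotics_holds : kernelK_asymptotics E`.

Proof, following the printed one («completing the square … change of variable … By the dominated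
convergence theorem, it is easy to show that the above integral converges to
`∫ (2√λ)^{d/2} e^{−2λ^{3/2}s²} ds`»), with one bookkeeping deviation: the printed substitution
`s = (t − ‖x‖/(2√λ))/√‖x‖` produces the varying domain `(−½√(‖x‖/λ), ∞)`; we substitute instead
`t = (‖x‖/(2m)) e^{2w/√κ}`, `κ = m‖x‖/2` (`integral_image_eq_integral_abs_deriv_smul`), which maps
`ℝ` onto `(0, ∞)` and completes the square as `‖x‖²/(4t) + m²t = 2κ cosh(2w/√κ) = m‖x‖ + 4κ sinh²(w/√κ)`:
`K(x) = (2/√π) A(x) ∫ e^{(2−d)w/√κ} e^{−4κ sinh²(w/√κ)} dw` with `A(x)` the claimed asymptotic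
(`kernelK_eq`), and the dominated convergence theorem (dominator `e^{(d−2)²/8} e^{−2w²}`, from
`sinh² y ≥ y²`; pointwise limit `e^{−4w²}` from `sinh y / y → 1`) gives
`∫ → ∫ e^{−4w²} dw = √π/2` (`tendsto_integral_laplace`). Theorems only; no new definitions, no new
named facts.
-/

noncomputable section

open MeasureTheory Set Filter Topology Bornology
open Literature.Analysis.UnboundedOperators

namespace Literature.MathematicalPhysics.QuantumFieldTheory.Chatterjee2026YMHiggs

/-! ### Laplace's method for `∫ e^{a y} e^{−4κ sinh² y}`, `y = w/√κ` -/

section Laplace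

/-- `y² ≤ sinh² y`. [folklore] -/
private theorem sq_le_sinh_sq (y : ℝ) : y ^ 2 ≤ Real.sinh y ^ 2 := by
  rw [sq_le_sq]
  rcases le_total 0 y with hy | hy
  · rw [abs_of_nonneg hy, abs_of_nonneg (Real.sinh_nonneg_iff.2 hy)]
    exact Real.self_le_sinh_iff.2 hy
  · have h1 : Real.sinh y ≤ 0 := by
      have := Real.sinh_le_self_iff.2 hy
      linarith
    rw [abs_of_nonpos hy, abs_of_nonpos h1, neg_le_neg_iff]
    exact Real.sinh_le_self_iff.2 hy

/-- `sinh y / y → 1` as `y → 0`, `y ≠ 0` (the derivative of `sinh` at `0`). [folklore] -/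
private theorem tendsto_sinh_div :
    Tendsto (fun y : ℝ => Real.sinh y / y) (𝓝[≠] 0) (𝓝 1) := by
  have h := Real.hasDerivAt_sinh 0
  rw [hasDerivAt_iff_tendsto_slope, Real.cosh_zero] at h
  refine h.congr' ?_
  filter_upwards [self_mem_nhdsWithin] with y _
  rw [slope_def_field, Real.sinh_zero, sub_zero, sub_zero]

/-- **The dominated-convergence step of Lemma 4.7**: for every real `a`,
`∫ e^{a w/√κ} e^{−4κ sinh²(w/√κ)} dw → ∫ e^{−4w²} dw` as `κ → ∞` (dominator `e^{a²/8} e^{−2w²}`,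
valid for `κ ≥ 1` since `κ sinh²(w/√κ) ≥ w²` and `a w/√κ ≤ |a||w| ≤ 2w² + a²/8`; pointwise limit from
`sinh y/y → 1`). [cite: Chatterjee2026YMHiggs, Lemma 4.7 (§4.5, proof: dominated convergence)] -/
theorem tendsto_integral_laplace (a : ℝ) :
    Tendsto (fun κ : ℝ => ∫ w : ℝ, Real.exp (a * (w / √κ)) *
        Real.exp (-(4 * (κ * Real.sinh (w / √κ) ^ 2)))) atTop
      (𝓝 (∫ w : ℝ, Real.exp (-4 * w ^ 2))) := by
  refine tendsto_integral_filter_of_dominated_convergence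
    (fun w => Real.exp (a ^ 2 / 8) * Real.exp (-2 * w ^ 2)) ?_ ?_ ?_ ?_
  · exact Eventually.of_forall fun κ => (by fun_prop : Continuous fun w : ℝ =>
      Real.exp (a * (w / √κ)) * Real.exp (-(4 * (κ * Real.sinh (w / √κ) ^ 2)))).aestronglyMeasurable
  · filter_upwards [eventually_ge_atTop (1 : ℝ)] with κ hκ
    refine ae_of_all _ fun w => ?_
    have hκ0 : 0 < κ := by linarith
    have hsq : 1 ≤ √κ := by
      rw [show (1 : ℝ) = √1 from Real.sqrt_one.symm]
      exact Real.sqrt_le_sqrt hκ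
    rw [Real.norm_of_nonneg (by positivity)]
    have h1 : a * (w / √κ) ≤ a ^ 2 / 8 + 2 * w ^ 2 := by
      have h : a * (w / √κ) ≤ |a| * |w| := by
        calc a * (w / √κ) ≤ |a * (w / √κ)| := le_abs_self _
          _ = |a| * (|w| / √κ) := by rw [abs_mul, abs_div, abs_of_pos (by positivity : (0 : ℝ) < √κ)]
          _ ≤ |a| * |w| := mul_le_mul_of_nonneg_left (div_le_self (abs_nonneg w) hsq) (abs_nonneg a)
      nlinarith [sq_nonneg (|w| - |a| / 4), sq_abs w, sq_abs a]
    have h2 : w ^ 2 ≤ κ * Real.sinh (w / √κ) ^ 2 := by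
      have h := sq_le_sinh_sq (w / √κ)
      have hk : (w / √κ) ^ 2 = w ^ 2 / κ := by rw [div_pow, Real.sq_sqrt hκ0.le]
      rw [hk, div_le_iff₀ hκ0] at h
      linarith
    calc Real.exp (a * (w / √κ)) * Real.exp (-(4 * (κ * Real.sinh (w / √κ) ^ 2)))
        ≤ Real.exp (a ^ 2 / 8 + 2 * w ^ 2) * Real.exp (-(4 * w ^ 2)) :=
          mul_le_mul (Real.exp_le_exp.2 h1) (Real.exp_le_exp.2 (by linarith)) (Real.exp_nonneg _)
            (Real.exp_nonneg _)
      _ = Real.exp (a ^ 2 / 8) * Real.exp (-2 * w ^ 2) := by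
          rw [← Real.exp_add, ← Real.exp_add]
          congr 1
          ring
  · exact (integrable_exp_neg_mul_sq (by norm_num : (0 : ℝ) < 2)).const_mul _
  · refine ae_of_all _ fun w => ?_
    have hlim1 : Tendsto (fun κ : ℝ => Real.exp (a * (w / √κ))) atTop (𝓝 1) := by
      have h : Tendsto (fun κ : ℝ => a * (w / √κ)) atTop (𝓝 0) := by
        have := (tendsto_const_nhds (x := a * w)).div_atTop Real.tendsto_sqrt_atTop
        refine this.congr fun κ => ?_
        ring
      have h2 := (Real.continuous_exp.tendsto 0).comp h
      rw [Real.exp_zero] at h2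
      exact h2
    have hlim2 : Tendsto (fun κ : ℝ => κ * Real.sinh (w / √κ) ^ 2) atTop (𝓝 (w ^ 2)) := by
      by_cases hw : w = 0
      · subst hw
        simp only [zero_div, Real.sinh_zero, zero_pow two_ne_zero, mul_zero]
        exact tendsto_const_nhds
      · have hy : Tendsto (fun κ : ℝ => w / √κ) atTop (𝓝[≠] 0) := by
          refine tendsto_nhdsWithin_iff.2 ⟨tendsto_const_nhds.div_atTop Real.tendsto_sqrt_atTop, ?_⟩
          filter_upwards [eventually_gt_atTop (0 : ℝ)] with κ hκ
          exact div_ne_zero hw (Real.sqrt_pos.2 hκ).ne'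
        have h3 := tendsto_sinh_div.comp hy
        have h4 : Tendsto (fun κ : ℝ => w ^ 2 * (Real.sinh (w / √κ) / (w / √κ)) ^ 2) atTop
            (𝓝 (w ^ 2 * 1 ^ 2)) := tendsto_const_nhds.mul (h3.pow 2)
        rw [one_pow, mul_one] at h4
        refine h4.congr' ?_
        filter_upwards [eventually_gt_atTop (0 : ℝ)] with κ hκ
        have hs : √κ ≠ 0 := (Real.sqrt_pos.2 hκ).ne'
        rw [div_pow, div_pow, Real.sq_sqrt hκ.le]
        field_simp
    have h := hlim1.mul ((Real.continuous_exp.tendsto _).comp ((hlim2.const_mul 4).neg))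
    rw [one_mul] at h
    refine (h.congr fun κ => rfl).trans ?_
    simp only [neg_mul]
    exact le_rfl

/-- `(2/√π) ∫ e^{a w/√κ} e^{−4κ sinh²(w/√κ)} dw → 1` as `κ → ∞` (`∫ e^{−4w²} = √π/2`).
[cite: Chatterjee2026YMHiggs, Lemma 4.7 (§4.5, proof)] -/
theorem tendsto_integral_laplace_normalised (a : ℝ) :
    Tendsto (fun κ : ℝ => 2 / √Real.pi * ∫ w : ℝ, Real.exp (a * (w / √κ)) *
        Real.exp (-(4 * (κ * Real.sinh (w / √κ) ^ 2)))) atTop (𝓝 1) := by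
  have h := (tendsto_integral_laplace a).const_mul (2 / √Real.pi)
  rw [integral_gaussian] at h
  have hval : 2 / √Real.pi * √(Real.pi / 4) = 1 := by
    rw [Real.sqrt_div' Real.pi (by norm_num : (0 : ℝ) ≤ 4),
      show (4 : ℝ) = 2 ^ 2 by norm_num, Real.sqrt_sq (by norm_num : (0 : ℝ) ≤ 2)]
    have hπ : 0 < √Real.pi := Real.sqrt_pos.2 Real.pi_pos
    field_simp
  rwa [hval] at h

end Laplace

/-! ### The substitution `t = (‖x‖/2m) e^{2w/√κ}` -/

section Kernel

/-- `4κ sinh² y = κ e^{2y} + κ e^{−2y} − 2κ`. [folklore] -/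
private theorem four_mul_sinh_sq (κ y : ℝ) :
    4 * (κ * Real.sinh y ^ 2) = κ * Real.exp (2 * y) + κ * (Real.exp (2 * y))⁻¹ - 2 * κ := by
  have hE : Real.exp (2 * y) = Real.exp y ^ 2 := by rw [sq, ← Real.exp_add]; ring_nf
  rw [Real.sinh_eq, Real.exp_neg, hE]
  have hey : Real.exp y ≠ 0 := (Real.exp_pos y).ne'
  field_simp
  ring

/-- The integrand after the substitution `t = c e^{2y}`, `c = r/(2m)`, `y = w/√κ`, `κ = mr/2`
(completing the square: `m²t + r²/(4t) = κ(e^{2y} + e^{−2y}) = 2κ + 4κ sinh² y`). [folklore] -/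
private theorem integrand_subst {m r κ c : ℝ} (hm : 0 < m) (hr : 0 < r) (hc : c = r / (2 * m))
    (hκ : κ = m * r / 2) (hκ0 : 0 < κ) (dd w : ℝ) :
    |c * (Real.exp (2 / √κ * w) * (2 / √κ * 1))| •
        (Real.exp (-m ^ 2 * (c * Real.exp (2 / √κ * w))) *
          ((4 * Real.pi * (c * Real.exp (2 / √κ * w))) ^ (-dd / 2) *
            Real.exp (-r ^ 2 / (4 * (c * Real.exp (2 / √κ * w)))))) =
      (2 * c / √κ * (4 * Real.pi * c) ^ (-dd / 2) * Real.exp (-(2 * κ))) *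
        (Real.exp ((2 - dd) * (w / √κ)) * Real.exp (-(4 * (κ * Real.sinh (w / √κ) ^ 2)))) := by
  have hsq : (0 : ℝ) < √κ := Real.sqrt_pos.2 hκ0
  set y := w / √κ with hy
  have hkw : 2 / √κ * w = 2 * y := by rw [hy]; field_simp
  rw [hkw]
  have hc0 : 0 < c := by rw [hc]; positivity
  have hE0 : 0 < Real.exp (2 * y) := Real.exp_pos _
  have h4split : (4 * Real.pi * (c * Real.exp (2 * y))) ^ (-dd / 2) =
      (4 * Real.pi * c) ^ (-dd / 2) * Real.exp (2 * y * (-dd / 2)) := by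
    rw [show 4 * Real.pi * (c * Real.exp (2 * y)) = (4 * Real.pi * c) * Real.exp (2 * y) by ring,
      Real.mul_rpow (by positivity) hE0.le, ← Real.exp_mul]
  have h1 : m ^ 2 * c = κ := by rw [hc, hκ]; field_simp
  have h2 : r ^ 2 / (4 * c) = κ := by rw [hc, hκ]; field_simp; ring
  have e1 : -m ^ 2 * (c * Real.exp (2 * y)) = -(κ * Real.exp (2 * y)) := by rw [← h1]; ring
  have e2 : -r ^ 2 / (4 * (c * Real.exp (2 * y))) = -(κ * (Real.exp (2 * y))⁻¹) := by
    rw [← h2]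
    field_simp
  have e3 := four_mul_sinh_sq κ y
  calc |c * (Real.exp (2 * y) * (2 / √κ * 1))| •
        (Real.exp (-m ^ 2 * (c * Real.exp (2 * y))) *
          ((4 * Real.pi * (c * Real.exp (2 * y))) ^ (-dd / 2) *
            Real.exp (-r ^ 2 / (4 * (c * Real.exp (2 * y))))))
      = (2 * c / √κ * (4 * Real.pi * c) ^ (-dd / 2)) *
          (Real.exp (2 * y) * Real.exp (-m ^ 2 * (c * Real.exp (2 * y))) *
            Real.exp (2 * y * (-dd / 2)) * Real.exp (-r ^ 2 / (4 * (c * Real.exp (2 * y))))) := by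
        rw [abs_of_pos (by positivity), smul_eq_mul, h4split]
        ring
    _ = (2 * c / √κ * (4 * Real.pi * c) ^ (-dd / 2)) *
          Real.exp (2 * y + -m ^ 2 * (c * Real.exp (2 * y)) + 2 * y * (-dd / 2) +
            -r ^ 2 / (4 * (c * Real.exp (2 * y)))) := by
        rw [Real.exp_add, Real.exp_add, Real.exp_add]
    _ = (2 * c / √κ * (4 * Real.pi * c) ^ (-dd / 2)) *
          Real.exp (-(2 * κ) + (2 - dd) * y + -(4 * (κ * Real.sinh y ^ 2))) := by
        congr 1
        congr 1
        rw [e1, e2, e3]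
        ring
    _ = (2 * c / √κ * (4 * Real.pi * c) ^ (-dd / 2) * Real.exp (-(2 * κ))) *
          (Real.exp ((2 - dd) * y) * Real.exp (-(4 * (κ * Real.sinh y ^ 2)))) := by
        rw [Real.exp_add, Real.exp_add]
        ring

variable {E : Type*} [NormedAddCommGroup E] [InnerProductSpace ℝ E]

/-- **The kernel after the substitution** `t = (‖x‖/2m) e^{2w/√κ}`, `κ = m‖x‖/2` (the printed
«making the change of variable … in the above integral yields»):
`K(x) = (2c/√κ)(4πc)^{−d/2} e^{−2κ} ∫ e^{(2−d) w/√κ} e^{−4κ sinh²(w/√κ)} dw`, `c = ‖x‖/(2m)`.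
[cite: Chatterjee2026YMHiggs, Lemma 4.7 (§4.5, proof: the change of variable)] -/
theorem integral_kernelK_subst {m : ℝ} (hm : 0 < m) {x : E} (hx : x ≠ 0) :
    ∫ t in Ioi (0 : ℝ), Real.exp (-m ^ 2 * t) * heatKernel t x =
      (2 * (‖x‖ / (2 * m)) / √(m * ‖x‖ / 2) *
          (4 * Real.pi * (‖x‖ / (2 * m))) ^ (-(Module.finrank ℝ E : ℝ) / 2) *
            Real.exp (-(2 * (m * ‖x‖ / 2)))) *
        ∫ w : ℝ, Real.exp ((2 - (Module.finrank ℝ E : ℝ)) * (w / √(m * ‖x‖ / 2))) *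
          Real.exp (-(4 * (m * ‖x‖ / 2 * Real.sinh (w / √(m * ‖x‖ / 2)) ^ 2))) := by
  set r : ℝ := ‖x‖ with hr_def
  set c : ℝ := r / (2 * m) with hc
  set κ : ℝ := m * r / 2 with hκ
  set dd : ℝ := (Module.finrank ℝ E : ℝ) with hdd
  have hr : 0 < r := norm_pos_iff.2 hx
  have hκ0 : 0 < κ := by rw [hκ]; positivity
  have hc0 : 0 < c := by rw [hc]; positivity
  set k : ℝ := 2 / √κ with hk
  have hk0 : 0 < k := by rw [hk]; exact div_pos two_pos (Real.sqrt_pos.2 hκ0)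
  -- the substitution map `f w = c e^{k w}`
  set f : ℝ → ℝ := fun w => c * Real.exp (k * w) with hf
  have hderiv : ∀ w, HasDerivAt f (c * (Real.exp (k * w) * (k * 1))) w := fun w =>
    ((hasDerivAt_id w).const_mul k).exp.const_mul c
  have hinj : InjOn f univ := fun a _ b _ hab => by
    simp only [hf] at hab
    have h := mul_left_cancel₀ hc0.ne' hab
    rw [Real.exp_eq_exp] at h
    exact mul_left_cancel₀ hk0.ne' h
  have himage : f '' univ = Ioi 0 := by
    ext t
    constructor
    · rintro ⟨w, -, rfl⟩
      exact mul_pos hc0 (Real.exp_pos _)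
    · intro ht
      refine ⟨Real.log (t / c) / k, trivial, ?_⟩
      simp only [hf]
      have h1 : k * (Real.log (t / c) / k) = Real.log (t / c) := by field_simp
      rw [h1, Real.exp_log (div_pos ht hc0)]
      field_simp
  rw [← himage, integral_image_eq_integral_abs_deriv_smul MeasurableSet.univ
      (fun w _ => (hderiv w).hasDerivWithinAt) hinj, Measure.restrict_univ, ← integral_const_mul]
  refine integral_congr_ae (ae_of_all _ fun w => ?_)
  simp only [hf, heatKernel]
  exact integrand_subst hm hr hc hκ hκ0 dd w

/-- **The constants of Lemma 4.7**: `(2c/√κ)(4πc)^{−d/2} e^{−2κ} = (2/√π) ·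
λ^{(d−3)/4} e^{−√λ r}/(2(2π)^{(d−1)/2} r^{(d−1)/2})` (`c = r/(2m)`, `κ = mr/2`, `√λ = m`).
[cite: Chatterjee2026YMHiggs, Lemma 4.7 (§4.5, proof: «This gives the desired result»)] -/
theorem kernelK_constants {m r : ℝ} (hm : 0 < m) (hr : 0 < r) (dd : ℝ) :
    2 * (r / (2 * m)) / √(m * r / 2) * (4 * Real.pi * (r / (2 * m))) ^ (-dd / 2) *
        Real.exp (-(2 * (m * r / 2))) =
      2 / √Real.pi * (m ^ ((dd - 3) / 2) * Real.exp (-(m * r)) /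
        (2 * (2 * Real.pi) ^ ((dd - 1) / 2) * r ^ ((dd - 1) / 2))) := by
  have hπ := Real.pi_pos
  have hL : 0 < 2 * (r / (2 * m)) / √(m * r / 2) * (4 * Real.pi * (r / (2 * m))) ^ (-dd / 2) *
      Real.exp (-(2 * (m * r / 2))) := by positivity
  have hR : 0 < 2 / √Real.pi * (m ^ ((dd - 3) / 2) * Real.exp (-(m * r)) /
      (2 * (2 * Real.pi) ^ ((dd - 1) / 2) * r ^ ((dd - 1) / 2))) := by positivity
  refine Real.log_injOn_pos (mem_Ioi.2 hL) (mem_Ioi.2 hR) ?_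
  have h2 : (2 : ℝ) ≠ 0 := two_ne_zero
  have hm0 : m ≠ 0 := hm.ne'
  have hr0 : r ≠ 0 := hr.ne'
  have hπ0 : Real.pi ≠ 0 := hπ.ne'
  have hlog4 : Real.log 4 = 2 * Real.log 2 := by
    rw [show (4 : ℝ) = 2 ^ 2 by norm_num, Real.log_pow]
    norm_num
  -- expand the left-hand side
  have eA : Real.log (2 * (r / (2 * m)) / √(m * r / 2)) =
      Real.log 2 + (Real.log r - (Real.log 2 + Real.log m)) -
        (Real.log m + Real.log r - Real.log 2) / 2 := by
    rw [Real.log_div (by positivity) (by positivity), Real.log_mul h2 (by positivity),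
      Real.log_div hr0 (by positivity), Real.log_mul h2 hm0, Real.log_sqrt (by positivity),
      Real.log_div (by positivity) h2, Real.log_mul hm0 hr0]
  have eB : Real.log ((4 * Real.pi * (r / (2 * m))) ^ (-dd / 2)) =
      -dd / 2 * (Real.log 4 + Real.log Real.pi + (Real.log r - (Real.log 2 + Real.log m))) := by
    rw [Real.log_rpow (by positivity), Real.log_mul (by positivity) (by positivity),
      Real.log_mul (by positivity) hπ0, Real.log_div hr0 (by positivity), Real.log_mul h2 hm0]
  have eL : Real.log (2 * (r / (2 * m)) / √(m * r / 2) * (4 * Real.pi * (r / (2 * m))) ^ (-dd / 2) *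
        Real.exp (-(2 * (m * r / 2)))) =
      (Real.log 2 + (Real.log r - (Real.log 2 + Real.log m)) -
          (Real.log m + Real.log r - Real.log 2) / 2) +
        -dd / 2 * (Real.log 4 + Real.log Real.pi + (Real.log r - (Real.log 2 + Real.log m))) +
        -(2 * (m * r / 2)) := by
    rw [Real.log_mul (by positivity) (by positivity), Real.log_mul (by positivity) (by positivity),
      Real.log_exp, eA, eB]
  -- expand the right-hand side
  have eC : Real.log (2 / √Real.pi) = Real.log 2 - Real.log Real.pi / 2 := by
    rw [Real.log_div h2 (by positivity), Real.log_sqrt hπ.le]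
  have eD : Real.log (m ^ ((dd - 3) / 2) * Real.exp (-(m * r)) /
        (2 * (2 * Real.pi) ^ ((dd - 1) / 2) * r ^ ((dd - 1) / 2))) =
      (dd - 3) / 2 * Real.log m + -(m * r) -
        (Real.log 2 + (dd - 1) / 2 * (Real.log 2 + Real.log Real.pi) + (dd - 1) / 2 * Real.log r) := by
    rw [Real.log_div (by positivity) (by positivity), Real.log_mul (by positivity) (by positivity),
      Real.log_rpow hm, Real.log_exp, Real.log_mul (by positivity) (by positivity),
      Real.log_mul h2 (by positivity), Real.log_rpow (by positivity), Real.log_mul h2 hπ0,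
      Real.log_rpow hr]
  have eR : Real.log (2 / √Real.pi * (m ^ ((dd - 3) / 2) * Real.exp (-(m * r)) /
        (2 * (2 * Real.pi) ^ ((dd - 1) / 2) * r ^ ((dd - 1) / 2)))) =
      (Real.log 2 - Real.log Real.pi / 2) +
        ((dd - 3) / 2 * Real.log m + -(m * r) -
          (Real.log 2 + (dd - 1) / 2 * (Real.log 2 + Real.log Real.pi) + (dd - 1) / 2 * Real.log r)) := by
    rw [Real.log_mul (by positivity) (by positivity), eC, eD]
  rw [eL, eR, hlog4]
  ring

/-- **Lemma 4.7 in closed form**: for `x ≠ 0`, `K(x) = (2/√π) · A(x) · ∫ e^{(2−d)w/√κ}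
e^{−4κ sinh²(w/√κ)} dw` with `A(x)` the claimed asymptotic equivalent and `κ = m‖x‖/2`.
[cite: Chatterjee2026YMHiggs, Lemma 4.7 (§4.5, proof)] -/
theorem kernelK_eq {m : ℝ} (hm : 0 < m) {x : E} (hx : x ≠ 0) :
    ∫ t in Ioi (0 : ℝ), Real.exp (-m ^ 2 * t) * heatKernel t x =
      2 / √Real.pi *
        (m ^ (((Module.finrank ℝ E : ℝ) - 3) / 2) * Real.exp (-(m * ‖x‖)) /
          (2 * (2 * Real.pi) ^ (((Module.finrank ℝ E : ℝ) - 1) / 2) *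
            ‖x‖ ^ (((Module.finrank ℝ E : ℝ) - 1) / 2))) *
        ∫ w : ℝ, Real.exp ((2 - (Module.finrank ℝ E : ℝ)) * (w / √(m * ‖x‖ / 2))) *
          Real.exp (-(4 * (m * ‖x‖ / 2 * Real.sinh (w / √(m * ‖x‖ / 2)) ^ 2))) := by
  rw [integral_kernelK_subst hm hx, kernelK_constants hm (norm_pos_iff.2 hx)]

/-! ### Lemma 4.7 -/

/-- **Chatterjee 2026, Lemma 4.7** — discharge of the named fact `kernelK_asymptotics`: for `d ≥ 2`
(not used) and `m > 0`, `K_λ(x) / (λ^{(d−3)/4} e^{−√λ‖x‖}/(2(2π)^{(d−1)/2}‖x‖^{(d−1)/2})) → 1` as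
`‖x‖ → ∞`. Proof: `kernelK_eq` and `tendsto_integral_laplace_normalised`, composed with
`κ = m‖x‖/2 → ∞` along the cobounded filter. [cite: Chatterjee2026YMHiggs, Lemma 4.7 (§4.5)] -/
theorem kernelK_asymptotics_holds : kernelK_asymptotics E := by
  intro _ m hm
  have hπ : 0 < √Real.pi := Real.sqrt_pos.2 Real.pi_pos
  have hκ : Tendsto (fun x : E => m * ‖x‖ / 2) (cobounded E) atTop :=
    (tendsto_norm_cobounded_atTop.const_mul_atTop hm).atTop_div_const two_pos
  have hlim := (tendsto_integral_laplace_normalised (2 - (Module.finrank ℝ E : ℝ))).comp hκ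
  refine hlim.congr' ?_
  filter_upwards [eventually_ne_cobounded (0 : E)] with x hx
  have hA : 0 < m ^ (((Module.finrank ℝ E : ℝ) - 3) / 2) * Real.exp (-(m * ‖x‖)) /
      (2 * (2 * Real.pi) ^ (((Module.finrank ℝ E : ℝ) - 1) / 2) *
        ‖x‖ ^ (((Module.finrank ℝ E : ℝ) - 1) / 2)) := by
    have hxn : 0 < ‖x‖ := norm_pos_iff.2 hx
    positivity
  rw [Function.comp_apply, kernelK_eq hm hx]
  field_simp

end Kernel

end Literature.MathematicalPhysics.QuantumFieldTheory.Chatterjee2026YMHiggs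

end
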